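import Literature.Analysis.ValidatedNumerics.IntervalPolynomial
import Mathlib.Tactic.Linarith
import Mathlib.Tactic.Positivity
import Mathlib.Tactic.Ring
import Mathlib.Tactic.FieldSimp
import HarnessLib

/-!
# Exact integer coefficient lists and a Bernstein-form positivity certificate
(cell `pub-ising3x`, seat controls-1 gen 15; KERNEL PATH for the 2D γ (derivative-functional)
certificates, step 3a — the kernel's exact polynomial arithmetic — CONTROL-ONLY scaffolding)

HONEST FRAMING: lottery ticket; floor = tightest certified 3D Ising CFT bounds; no exact-solution
claim without a proof. Nothing numerical about any CFT is asserted here.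

The cells of a 2D γ-certificate reduce (`Control2DKernelCell`) to `P(y) ≥ 0` on a rational interval for ONE
integer polynomial `P` of degree `≈ 4N + Λ` per spin. The tree's validated sign checker
`PolyMP.posOn` (midpoint Taylor form + bisection) needs `≈ 100` leaves per spin on these (exact twin,
seat folder `work/twin`); the Bernstein form needs ONE. This file is the exact-integer layer the kernel
evaluates by `decide`:
* `castZ : List ℤ → List ℝ` and computable `zadd`, `zsmul`, `zmul`, `zshift` mirroring `PolyMP.addR/…`
  with the evaluation homomorphisms through `PolyMP.evalR ∘ castZ`;
* `zaff q a L p` = the coefficients of `q^{deg} · p((a + L t)/q)` in `t` (Horner, all integer);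
* `zbern cs = Σ_i cs_i X^i (1-X)^{d-i}` (`d + 1 = |cs|`), non-negative on `[0,1]` when all `cs_i ≥ 0`;
* `bernCheck p q a L cs := (∀ i, 0 ≤ cs_i) ∧ zaff q a L p = zbern cs` and its soundness
  `evalR_nonneg_of_bernCheck`: then `p ≥ 0` on `[a/q, (a+L)/q]` (`q > 0`, `L ≥ 0`).
The certificate `cs` (unnormalised Bernstein coefficients `Σ_{k≤i} C(d-k,i-k) a_k` of the transformed
polynomial) is produced outside and only CHECKED here (an identity of integer lists). Elementary; no facts.
References: [folklore] (Bernstein basis / Pólya positivity on a simplex); the tree's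
`Literature.Analysis.ValidatedNumerics.IntervalPolynomial` (`evalR`, `addR`, `mulR`, `shiftR`).
-/

namespace Summit.CriticalPhenomena.Ising3D.Control2D

open Literature.Analysis.ValidatedNumerics.PolyMP

/-! ### Integer coefficient lists and their real shadow -/

/-- The real coefficient list of an integer one. [folklore] -/
def castZ (l : List ℤ) : List ℝ := l.map fun z => (z : ℝ)

/-- [folklore] -/
@[simp] theorem castZ_nil : castZ [] = [] := rfl

/-- [folklore] -/
@[simp] theorem castZ_cons (a : ℤ) (as : List ℤ) : castZ (a :: as) = (a : ℝ) :: castZ as := rfl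

/-- Coefficientwise sum. [folklore] -/
def zadd : List ℤ → List ℤ → List ℤ
  | [], bs => bs
  | a :: as, [] => a :: as
  | a :: as, b :: bs => (a + b) :: zadd as bs

/-- [folklore] -/
theorem evalR_zadd : ∀ (as bs : List ℤ) (x : ℝ),
    evalR (castZ (zadd as bs)) x = evalR (castZ as) x + evalR (castZ bs) x
  | [], bs, x => by simp [zadd]
  | a :: as, [], x => by simp [zadd]
  | a :: as, b :: bs, x => by
      simp only [zadd, castZ_cons, evalR_cons, Int.cast_add, evalR_zadd as bs x]; ring

/-- Scalar multiple. [folklore] -/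
def zsmul (c : ℤ) (as : List ℤ) : List ℤ := as.map (c * ·)

/-- [folklore] -/
theorem evalR_zsmul (c : ℤ) : ∀ (as : List ℤ) (x : ℝ),
    evalR (castZ (zsmul c as)) x = (c : ℝ) * evalR (castZ as) x
  | [], x => by simp [zsmul]
  | a :: as, x => by
      have h := evalR_zsmul c as x
      simp only [zsmul, List.map_cons, castZ_cons, evalR_cons, Int.cast_mul] at h ⊢
      rw [h]; ring

/-- Product. [folklore] -/
def zmul : List ℤ → List ℤ → List ℤ
  | [], _ => []
  | a :: as, bs => zadd (zsmul a bs) (0 :: zmul as bs)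

/-- [folklore] -/
theorem evalR_zmul : ∀ (as bs : List ℤ) (x : ℝ),
    evalR (castZ (zmul as bs)) x = evalR (castZ as) x * evalR (castZ bs) x
  | [], bs, x => by simp [zmul]
  | a :: as, bs, x => by
      rw [zmul, evalR_zadd, evalR_zsmul]
      simp only [castZ_cons, evalR_cons, Int.cast_zero, evalR_zmul as bs x]; ring

/-- One Horner step of the Taylor shift. [folklore] -/
def zshiftStep (c a : ℤ) (acc : List ℤ) : List ℤ := zadd [a] (zadd (zsmul c acc) (0 :: acc))

/-- Taylor shift by an integer: the coefficients of `p(c + y)` in `y`. [folklore] -/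
def zshift (as : List ℤ) (c : ℤ) : List ℤ := as.foldr (zshiftStep c) []

/-- [folklore] -/
theorem evalR_zshiftStep (c a : ℤ) (acc : List ℤ) (y : ℝ) :
    evalR (castZ (zshiftStep c a acc)) y = (a : ℝ) + ((c : ℝ) + y) * evalR (castZ acc) y := by
  simp only [zshiftStep, evalR_zadd, evalR_zsmul, castZ_cons, castZ_nil, evalR_cons, evalR_nil,
    Int.cast_zero]; ring

/-- [folklore] -/
theorem evalR_zshift (c : ℤ) : ∀ (as : List ℤ) (y : ℝ),
    evalR (castZ (zshift as c)) y = evalR (castZ as) ((c : ℝ) + y)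
  | [], y => by simp [zshift]
  | a :: as, y => by
      have h := evalR_zshift c as y
      simp only [zshift, List.foldr_cons] at h ⊢
      rw [evalR_zshiftStep, h, castZ_cons, evalR_cons]

/-! ### The affine transform to the unit interval (all integer) -/

/-- `(a + L X) · r`. [folklore] -/
def zlin (a L : ℤ) (r : List ℤ) : List ℤ := zadd (zsmul a r) (0 :: zsmul L r)

/-- [folklore] -/
theorem evalR_zlin (a L : ℤ) (r : List ℤ) (t : ℝ) :
    evalR (castZ (zlin a L r)) t = ((a : ℝ) + L * t) * evalR (castZ r) t := by
  simp only [zlin, evalR_zadd, evalR_zsmul, castZ_cons, evalR_cons, Int.cast_zero]; ring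

/-- Horner form of `q^{|p|-1} · p((a + L t)/q)` as an integer coefficient list in `t`. [folklore] -/
def zaff (q a L : ℤ) : List ℤ → List ℤ
  | [] => []
  | c :: cs => zadd [c * q ^ cs.length] (zlin a L (zaff q a L cs))

/-- **`zaff` evaluates to `q^{|p|-1} p((a + L t)/q)`** (`q ≠ 0`). [folklore] -/
theorem evalR_zaff {q : ℤ} (hq : (q : ℝ) ≠ 0) (a L : ℤ) (t : ℝ) : ∀ p : List ℤ,
    evalR (castZ (zaff q a L p)) t =
      (q : ℝ) ^ (p.length - 1) * evalR (castZ p) (((a : ℝ) + L * t) / q)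
  | [] => by simp [zaff]
  | [c] => by
      simp [zaff, zlin, zadd, zsmul, castZ]
  | c :: c' :: cs => by
      have ih := evalR_zaff hq a L t (c' :: cs)
      rw [zaff, evalR_zadd, evalR_zlin, ih]
      simp only [castZ_cons, castZ_nil, evalR_cons, evalR_nil, Int.cast_mul, Int.cast_pow,
        List.length_cons, Nat.add_sub_cancel, pow_succ]
      field_simp
      ring

/-! ### The Bernstein form -/

/-- `(1 - X)^n`. [folklore] -/
def zOneSub : ℕ → List ℤ
  | 0 => [1]
  | n + 1 => zmul [1, -1] (zOneSub n)

/-- [folklore] -/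
theorem evalR_zOneSub (t : ℝ) : ∀ n : ℕ, evalR (castZ (zOneSub n)) t = (1 - t) ^ n
  | 0 => by simp [zOneSub]
  | n + 1 => by
      rw [zOneSub, evalR_zmul, evalR_zOneSub t n]
      simp only [castZ_cons, castZ_nil, evalR_cons, evalR_nil, Int.cast_one, Int.cast_neg]
      ring

/-- `Σ_i cs_i X^i (1-X)^{d-i}` with `d + 1 = |cs|`. [folklore] -/
def zbern : List ℤ → List ℤ
  | [] => []
  | c :: cs => zadd (zsmul c (zOneSub cs.length)) (0 :: zbern cs)

/-- **The Bernstein form of a non-negative list is non-negative on `[0,1]`.** [folklore] -/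
theorem evalR_zbern_nonneg {t : ℝ} (ht0 : 0 ≤ t) (ht1 : t ≤ 1) :
    ∀ cs : List ℤ, (∀ c ∈ cs, (0 : ℤ) ≤ c) → 0 ≤ evalR (castZ (zbern cs)) t
  | [], _ => by simp [zbern]
  | c :: cs, h => by
      rw [zbern, evalR_zadd, evalR_zsmul, evalR_zOneSub]
      simp only [castZ_cons, evalR_cons, Int.cast_zero, zero_add]
      have hc : (0 : ℝ) ≤ c := by exact_mod_cast h c (by simp)
      have ih := evalR_zbern_nonneg ht0 ht1 cs fun c' hc' => h c' (by simp [hc'])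
      have h1 : (0 : ℝ) ≤ 1 - t := by linarith
      positivity

/-! ### The certificate check and its soundness -/

/-- **Bernstein certificate check** for `p ≥ 0` on `[a/q, (a+L)/q]`: the supplied coefficients `cs` are
all `≥ 0` and the transformed polynomial `zaff q a L p` is literally the Bernstein form `zbern cs`.
Decidable by `decide` (exact integer list arithmetic). [folklore] -/
def bernCheck (p : List ℤ) (q a L : ℤ) (cs : List ℤ) : Bool :=
  cs.all (fun c => decide (0 ≤ c)) && decide (zaff q a L p = zbern cs)

/-- **Soundness of the Bernstein certificate**: `bernCheck p q a L cs = true`, `q > 0`, `L ≥ 0` give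
`p(x) ≥ 0` for `a/q ≤ x ≤ (a+L)/q`. PROVED (write `x = (a + L t)/q` with `t ∈ [0,1]`; then
`q^{|p|-1} p(x) = zbern cs (t) ≥ 0`). [folklore] -/
theorem evalR_nonneg_of_bernCheck {p cs : List ℤ} {q a L : ℤ} (hq : 0 < q) (hL : 0 ≤ L)
    (h : bernCheck p q a L cs = true) {x : ℝ} (hlo : (a : ℝ) / q ≤ x)
    (hhi : x ≤ ((a : ℝ) + L) / q) : 0 ≤ evalR (castZ p) x := by
  simp only [bernCheck, Bool.and_eq_true, List.all_eq_true, decide_eq_true_eq] at h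
  obtain ⟨hall, heq⟩ := h
  have hqR : (0 : ℝ) < q := by exact_mod_cast hq
  have hLR : (0 : ℝ) ≤ L := by exact_mod_cast hL
  have hqx1 : (a : ℝ) ≤ q * x := by rwa [div_le_iff₀ hqR, mul_comm] at hlo
  have hqx2 : (q : ℝ) * x ≤ a + L := by rwa [le_div_iff₀ hqR, mul_comm] at hhi
  -- a parameter `t ∈ [0,1]` with `a + L t = q x`
  obtain ⟨t, ht0, ht1, ht⟩ : ∃ t : ℝ, 0 ≤ t ∧ t ≤ 1 ∧ (a : ℝ) + L * t = q * x := by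
    rcases hLR.lt_or_eq with hLpos | hL0
    · refine ⟨((q : ℝ) * x - a) / L, div_nonneg (by linarith) hLpos.le, ?_, ?_⟩
      · rw [div_le_one hLpos]; linarith
      · field_simp; ring
    · refine ⟨0, le_rfl, zero_le_one, ?_⟩
      rw [← hL0] at hqx2; rw [← hL0]; linarith
  have hx : (((a : ℝ) + L * t) / q) = x := by rw [ht]; field_simp
  have key := evalR_zaff hqR.ne' a L t p
  rw [hx, heq] at key
  have hpos : (0 : ℝ) < (q : ℝ) ^ (p.length - 1) := pow_pos hqR _
  have hB := evalR_zbern_nonneg ht0 ht1 cs hall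
  rw [key] at hB
  exact (mul_nonneg_iff_of_pos_left hpos).mp hB

/-- **Corner test**: all coefficients of an integer list non-negative ⇒ the polynomial is `≥ 0` on
`[0, ∞)`. [folklore] -/
theorem evalR_nonneg_of_all_nonneg : ∀ (p : List ℤ), (∀ c ∈ p, (0 : ℤ) ≤ c) →
    ∀ {x : ℝ}, 0 ≤ x → 0 ≤ evalR (castZ p) x
  | [], _, x, _ => by simp
  | c :: cs, h, x, hx => by
      rw [castZ_cons, evalR_cons]
      have hc : (0 : ℝ) ≤ c := by exact_mod_cast h c (by simp)
      have ih := evalR_nonneg_of_all_nonneg cs (fun c' hc' => h c' (by simp [hc'])) hx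
      positivity

/-- The corner test as a `Bool`. [folklore] -/
def allNonneg (p : List ℤ) : Bool := p.all fun c => decide (0 ≤ c)

/-- Soundness of `allNonneg` after a shift: `allNonneg (zshift p c)` ⇒ `p(x) ≥ 0` for `x ≥ c`. [folklore] -/
theorem evalR_nonneg_of_allNonneg_shift {p : List ℤ} {c : ℤ} (h : allNonneg (zshift p c) = true)
    {x : ℝ} (hx : (c : ℝ) ≤ x) : 0 ≤ evalR (castZ p) x := by
  simp only [allNonneg, List.all_eq_true, decide_eq_true_eq] at h
  have := evalR_nonneg_of_all_nonneg (zshift p c) h (x := x - c) (by linarith)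
  rwa [evalR_zshift, show (c : ℝ) + (x - c) = x by ring] at this

end Summit.CriticalPhenomena.Ising3D.Control2D
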